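import Summits.HubbardSuperconductivity.HubbardLadder.Bounds.StiffnessFromEnergyBracketsTPrime
import Literature.MathematicalPhysics.QuantumLattice.HubbardLangerMattisMoments
import Literature.MathematicalPhysics.QuantumLattice.HubbardNNNHoppingWindowCertificate
import HarnessLib

/-!
# Hubbard ladder — Bounds: stiffness ceilings from certified ENERGY BRACKETS, part 3 — thermodynamic limit
# (bounds.tex Thm 3(ii) / Cor. hook in the thermodynamic limit, `t' = 0` and `t–t'` classes, typed AND proved)


HONEST FRAMING (cell pub-hubbard): ladder R1–R4 with certified numbers; no claim on H/H₀. These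
are bounds for MODEL CLASSES (the square-lattice Hubbard torus `hubbardTorus 2 L 1 U`, resp. the
`t–t'` torus `hubbardTorusTT' L 1 t' U`, every filling, every `U ≥ 0`); no materials claim.
Companion text: `pub-hubbard/paper/bounds.tex` §3 (Thm 3 = SHARPENING #2, "the hook from the R1
energy table to a certified stiffness / T_c ceiling"); tables `pub-hubbard/pub-hubbard-bounds/BOUNDS.md`
(row T3) and `EXTREMISERS.md` §5a (the certified column this file justifies).

Part 3 of 3 (part 1 = `StiffnessFromEnergyBrackets.lean`, the `t' = 0` torus and the notation; part 2 =
`StiffnessFromEnergyBracketsTPrime.lean`, the `t–t'` class on the finite torus).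

## What is proved (no `sorry`, no new axioms)

* `stiffness_le_of_energyDensity_slope`, `StiffnessCeilingFromEnergyDensityBrackets` (`@[conjecture]
  def`, PROVED by `…_holds` = `stiffness_le_of_energyDensityBrackets`) — **thermodynamic-limit form**
  (Thm 3(ii)): a stiffness constant `ρ_s` valid along all large even `L` satisfies
  `ρ_s ≤ (U (e(U) - e(U₁))/(U - U₁) - e(U)) / 4`, `e = ThermodynamicLimit.energyDensity2D 1 · (1-δ)`,
  hence `ρ_s ≤ (U (r - l₁)/(U - U₁) - em)/4` from thermodynamic-limit brackets `em ≤ e(U) ≤ r`,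
  `l₁ ≤ e(U₁)` (`0 ≤ U₁ < U`).
* `StiffnessCeilingHalfFillingU8` (`@[conjecture] def`, PROVED by `…_holds` =
  `stiffness_halfFilling_U8_le`) — worked instance consuming the tree's KERNEL lower bounds
  `energyDensity2D_one_four_one_ge` (`e(4) ≥ -1.0897`) and `energyDensity2D_one_eight_one_ge`
  (`e(8) ≥ -0.74512`, Langer–Mattis moments): at half filling, `U = 8`, any certified upper bound
  `e(8) ≤ r` gives `ρ_s ≤ (2 (r + 1.0897) + 0.74512)/4`. NUMBERS (honest): with the cell's certified
  `r = -0.4963187446` (plaquette-LUC, BRACKETS.md) this is `ρ_s ≤ 0.4830`, WEAKER than the one-body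
  half-bathtub `0.4053` (`HalfBathtubStiffnessBound`); with the cell's certified SDP brackets in place of
  the kernel Langer–Mattis ones the same formula gives the EXTREMISERS.md §5a column (certified there:
  `ρ_s ≤ 0.38440` at `n = 1`, `U = 8`, `U₁ = 4` and `≤ 0.30952` at `U = 12`, `U₁ = 8`, both BELOW the
  one-body `4/π² = 0.40528`). The hook is exact in the limit of tight brackets
  (`⟨-T⟩ = U ∂E/∂U - E` a.e. in `U`), so it improves monotonically with R1.
* `stiffnessTT'_le_of_energyDensity_slope`, `StiffnessCeilingFromEnergyDensityBracketsTT'`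
  (`@[conjecture] def`, PROVED by `…_holds`) — **thermodynamic-limit form for the `t–t'` class** over
  Ruelle's `t–t'` energy density `ThermodynamicLimit.energyDensityTT' 1 t' U n`
  (`HubbardNNNHoppingThermodynamicLimit`; `fluxEnergyTT'_zero_eq_groundEnergy` = the `SU(2)` sector
  reduction `groundEnergy_hubbardTorusTT'_eq_minEnergyOn_szSector`): for `t₃ < t' ≤ 0`, `0 ≤ U₁ < U`,
  `ρ_s ≤ (U (r - l₁)/(U - U₁) - em + t' (r - l₃)/(t₃ - t')) / 4` from TL brackets `em ≤ e_{t'}(U) ≤ r`,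
  `l₁ ≤ e_{t'}(U₁)`, `l₃ ≤ e_{t₃}(U)` — the shape of the tree's typed TL rows `clusterLowerTL_…` /
  `tlUpper_…`; `stiffnessCeilingFromEnergyDensityBrackets_of_TT'` recovers the `t' = 0` node.

References (keys of `lean/references.bib`): KomaTasaki1994 §1 (supergradient); HazraVermaRanderia2019
eqs. (2)–(6) and App. G; ParamekantiTrivediRanderia1998 eq. (3); ScalapinoWhiteZhang1993 §II;
LangerMattis1971 eqs. (3)–(5); LiebPRL1989 (sector reduction `E(2n) = E(2n, S^z = 0)`).
-/

noncomputable section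

namespace Summit.HubbardSuperconductivity.HubbardLadder.Bounds

open Matrix Finset Real Filter Topology
open Literature.MathematicalPhysics.QuantumLattice
open Literature.MathematicalPhysics.QuantumFieldTheory
open Literature.Probability.LatticeModels
open Literature.MathematicalPhysics.QuantumLattice.LangerMattis
open Literature.MathematicalPhysics.QuantumLattice.ThermodynamicLimit
open scoped ComplexOrder ComplexConjugate Topology

variable {L : ℕ} [NeZero L]

/-! ### Finite-volume inputs (zero-flux envelope = ground energy; the sharp finite-size ceiling) -/


/-- The zero-flux envelope is the `N_L`-particle ground energy `groundEnergyAt … (rectN (1-δ) L)`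
(`E(2n) = E(2n, S^z = 0)`, Lieb 1989). -/
theorem fluxEnergy_zero_eq_groundEnergyAt (U δ : ℝ) (hδ : -1 ≤ δ) :
    fluxEnergy L U δ 0 = groundEnergyAt (fermionTorusGraph 2 L) 1 U (rectN (1 - δ) L) := by
  have hn : ⌊(1 - δ) * (L : ℝ) ^ 2 / 2⌋₊ ≤ Fintype.card (FermionTorus 2 L) := by
    rw [NoGo.card_fermionTorus_two]; exact NoGo.floor_pairNumber_le δ hδ L
  rw [rectN, fluxEnergy_eq, hubbardTorusFlux_zero, groundEnergyAt_eq_minEnergyOn_szSector _ 1 U hn]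
  rfl

/-- The sharp form (exact energies in place of brackets): `ρ_s L² ≤ (U (E(U) - E(U₁))/(U - U₁) - E(U))/4`. -/
theorem stiffness_mul_sq_le_of_fluxEnergy (hL : 3 ≤ L) {U U₁ δ ρs θ₀ : ℝ} (hδ : -1 ≤ δ) (hU : 0 ≤ U)
    (hU₁ : U₁ < U) (hρs : 0 < ρs) (hθ₀ : 0 < θ₀)
    (hst : ∀ θ : ℝ, |θ| ≤ θ₀ → ρs * θ ^ 2 ≤ fluxEnergy L U δ θ - fluxEnergy L U δ 0) :
    ρs * (L : ℝ) ^ 2 ≤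
      (U * ((fluxEnergy L U δ 0 - fluxEnergy L U₁ δ 0) / (U - U₁)) - fluxEnergy L U δ 0) / 4 :=
  stiffnessCeilingFromEnergyBrackets_holds L hL U U₁ δ ρs θ₀ hδ hU hU₁ hρs hθ₀ hst _ _ _ le_rfl le_rfl
    le_rfl


/-! ### Thermodynamic limit (bounds.tex Thm 3(ii)) -/

/-- The energy per site of the `N_L(n)`-particle ground state of the `L × L` torus. -/
def torusEnergyPerSite (U n : ℝ) (L : ℕ) : ℝ :=
  groundEnergyAt (fermionTorusGraph 2 L) 1 U (rectN n L) / (L : ℝ) ^ 2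

/-- Arithmetic: divide the finite-volume chord ceiling `ρ c ≤ (U (E - E₁)/(U - U₁) - E)/4` by `c > 0`. -/
private theorem four_mul_le_of_sq {ρ U U₁ E E₁ c : ℝ} (hc : 0 < c)
    (h : ρ * c ≤ (U * ((E - E₁) / (U - U₁)) - E) / 4) :
    4 * ρ ≤ U * ((E / c - E₁ / c) / (U - U₁)) - E / c := by
  rw [← sub_div, div_right_comm, ← mul_div_assoc, ← sub_div, le_div_iff₀ hc]
  linarith

/-- **Thermodynamic-limit slope ceiling.** If `ρ_s > 0` is a flux stiffness of the `(N_L, S^z = 0)`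
sectors of `hubbardTorus 2 L 1 U` for all large even `L` (the same `ρ_s, θ₀` for every such `L`), then
for every `0 ≤ U₁ < U` and `-1 < δ ≤ 1`:
`ρ_s ≤ (U (e(U) - e(U₁))/(U - U₁) - e(U)) / 4`, `e(·) = energyDensity2D 1 · (1 - δ)`
(the finite-volume sharp form divided by `L²`, and `E_L/L² → e` along the tori, Ruelle 1969 §3.3). -/
theorem stiffness_le_of_energyDensity_slope {U U₁ δ ρs θ₀ : ℝ} (hU₁ : 0 ≤ U₁) (hU : U₁ < U)
    (hδ1 : -1 < δ) (hδ2 : δ ≤ 1) (hρs : 0 < ρs) (hθ₀ : 0 < θ₀) {L₀ : ℕ}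
    (hst : ∀ (L : ℕ) [NeZero L], L₀ ≤ L → Even L →
      ∀ θ : ℝ, |θ| ≤ θ₀ → ρs * θ ^ 2 ≤ fluxEnergy L U δ θ - fluxEnergy L U δ 0) :
    ρs ≤ (U * ((energyDensity2D 1 U (1 - δ) - energyDensity2D 1 U₁ (1 - δ)) / (U - U₁)) -
      energyDensity2D 1 U (1 - δ)) / 4 := by
  have hU0 : 0 ≤ U := hU₁.trans hU.le
  have hn0 : 0 ≤ 1 - δ := by linarith
  have hn2 : 1 - δ < 2 := by linarith
  have ha : Tendsto (torusEnergyPerSite U (1 - δ)) atTop (𝓝 (energyDensity2D 1 U (1 - δ))) :=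
    tendsto_energyDensity2D_torus 1 hU0 hn0 hn2
  have hb : Tendsto (torusEnergyPerSite U₁ (1 - δ)) atTop (𝓝 (energyDensity2D 1 U₁ (1 - δ))) :=
    tendsto_energyDensity2D_torus 1 hU₁ hn0 hn2
  have hg : Tendsto (fun L : ℕ => U * ((torusEnergyPerSite U (1 - δ) L -
      torusEnergyPerSite U₁ (1 - δ) L) / (U - U₁)) - torusEnergyPerSite U (1 - δ) L) atTop
      (𝓝 (U * ((energyDensity2D 1 U (1 - δ) - energyDensity2D 1 U₁ (1 - δ)) / (U - U₁)) -
        energyDensity2D 1 U (1 - δ))) :=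
    (((ha.sub hb).div_const (U - U₁)).const_mul U).sub ha
  have h2 : Tendsto (fun m : ℕ => 2 * m) atTop atTop :=
    tendsto_atTop_mono (fun m : ℕ => (by omega : m ≤ 2 * m)) tendsto_id
  have hev : ∀ᶠ m : ℕ in atTop, 4 * ρs ≤ U * ((torusEnergyPerSite U (1 - δ) (2 * m) -
      torusEnergyPerSite U₁ (1 - δ) (2 * m)) / (U - U₁)) - torusEnergyPerSite U (1 - δ) (2 * m) := by
    refine Filter.eventually_atTop.2 ⟨max L₀ 2, fun m hm => ?_⟩
    have hm2 : 2 ≤ m := le_trans (le_max_right _ _) hm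
    have hL₀ : L₀ ≤ 2 * m := le_trans (le_trans (le_max_left _ _) hm) (by omega)
    haveI : NeZero (2 * m) := ⟨by omega⟩
    have hL3 : 3 ≤ 2 * m := by omega
    have hfin := stiffness_mul_sq_le_of_fluxEnergy (L := 2 * m) hL3 hδ1.le hU0 hU hρs hθ₀
      (hst (2 * m) hL₀ (even_two_mul m))
    rw [fluxEnergy_zero_eq_groundEnergyAt (L := 2 * m) U δ hδ1.le,
      fluxEnergy_zero_eq_groundEnergyAt (L := 2 * m) U₁ δ hδ1.le] at hfin
    have hLpos : (0 : ℝ) < ((2 * m : ℕ) : ℝ) ^ 2 := by positivity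
    exact four_mul_le_of_sq hLpos hfin
  have hlim := ge_of_tendsto (hg.comp h2) hev
  linarith

/-- **Thermodynamic-limit certified-bracket stiffness ceiling.** Under the hypotheses of
`stiffness_le_of_energyDensity_slope`, thermodynamic-limit brackets `em ≤ e(U) ≤ r`, `l₁ ≤ e(U₁)`
(`e(·) = energyDensity2D 1 · (1 - δ)`) give `ρ_s ≤ (U (r - l₁)/(U - U₁) - em) / 4`. -/
theorem stiffness_le_of_energyDensityBrackets {U U₁ δ ρs θ₀ : ℝ} (hU₁ : 0 ≤ U₁) (hU : U₁ < U)
    (hδ1 : -1 < δ) (hδ2 : δ ≤ 1) (hρs : 0 < ρs) (hθ₀ : 0 < θ₀) {L₀ : ℕ}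
    (hst : ∀ (L : ℕ) [NeZero L], L₀ ≤ L → Even L →
      ∀ θ : ℝ, |θ| ≤ θ₀ → ρs * θ ^ 2 ≤ fluxEnergy L U δ θ - fluxEnergy L U δ 0)
    {em r l₁ : ℝ} (hem : em ≤ energyDensity2D 1 U (1 - δ)) (hr : energyDensity2D 1 U (1 - δ) ≤ r)
    (hl₁ : l₁ ≤ energyDensity2D 1 U₁ (1 - δ)) :
    ρs ≤ (U * ((r - l₁) / (U - U₁)) - em) / 4 := by
  have h := stiffness_le_of_energyDensity_slope hU₁ hU hδ1 hδ2 hρs hθ₀ hst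
  have hd : 0 < U - U₁ := sub_pos.2 hU
  have hmono : (energyDensity2D 1 U (1 - δ) - energyDensity2D 1 U₁ (1 - δ)) / (U - U₁) ≤
      (r - l₁) / (U - U₁) :=
    div_le_div_of_nonneg_right (by linarith) hd.le
  have hU0 : 0 ≤ U := hU₁.trans hU.le
  have hUD := mul_le_mul_of_nonneg_left hmono hU0
  linarith

/-- **Thermodynamic-limit certified-bracket stiffness ceiling (bounds.tex Thm 3(ii); PROVED below).**
For `0 ≤ U₁ < U`, `-1 < δ ≤ 1`: if `ρ_s > 0` is a flux stiffness (`ρ_s θ² ≤ E_L(θ) - E_L(0)` for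
`|θ| ≤ θ₀`) of the `(N_L, S^z = 0)` sectors of `hubbardTorus 2 L 1 U` for all even `L ≥ L₀`, then every
triple of thermodynamic-limit brackets `em ≤ e(U) ≤ r`, `l₁ ≤ e(U₁)`
(`e(·) = ThermodynamicLimit.energyDensity2D 1 · (1 - δ)`, Ruelle's ground-state energy density) gives
`ρ_s ≤ (U (r - l₁)/(U - U₁) - em) / 4`. -/
@[conjecture] def StiffnessCeilingFromEnergyDensityBrackets : Prop :=
  ∀ (U U₁ δ ρs θ₀ : ℝ), 0 ≤ U₁ → U₁ < U → -1 < δ → δ ≤ 1 → 0 < ρs → 0 < θ₀ →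
    (∃ L₀ : ℕ, ∀ (L : ℕ) [NeZero L], L₀ ≤ L → Even L →
      ∀ θ : ℝ, |θ| ≤ θ₀ → ρs * θ ^ 2 ≤ fluxEnergy L U δ θ - fluxEnergy L U δ 0) →
    ∀ (em r l₁ : ℝ), em ≤ energyDensity2D 1 U (1 - δ) → energyDensity2D 1 U (1 - δ) ≤ r →
      l₁ ≤ energyDensity2D 1 U₁ (1 - δ) → ρs ≤ (U * ((r - l₁) / (U - U₁)) - em) / 4

/-- **Proof of `StiffnessCeilingFromEnergyDensityBrackets`.** -/
theorem stiffnessCeilingFromEnergyDensityBrackets_holds : StiffnessCeilingFromEnergyDensityBrackets := by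
  intro U U₁ δ ρs θ₀ hU₁ hU hδ1 hδ2 hρs hθ₀ hst em r l₁ hem hr hl₁
  obtain ⟨L₀, hst⟩ := hst
  exact stiffness_le_of_energyDensityBrackets hU₁ hU hδ1 hδ2 hρs hθ₀ hst hem hr hl₁

/-- **Worked instance: half filling, `U = 8`, slope from `U₁ = 4` (PROVED below)**, consuming the
tree's KERNEL lower bounds `e(4) ≥ -1.0897`, `e(8) ≥ -0.74512` (`HubbardLangerMattisMoments`,
Langer–Mattis moments) and ANY certified upper bound `e(8) ≤ r`: a stiffness constant valid along all
large even `L` obeys `ρ_s ≤ (2 (r + 1.0897) + 0.74512)/4`. NUMBERS (honest): with the cell's certified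
`r = -0.4963187446` (plaquette LUC, BRACKETS.md) this is `ρ_s ≤ 0.4830`, WEAKER than the one-body
half-bathtub `0.4053` (`HalfBathtubStiffnessBound`); recorded as an honest negative in EXTREMISERS.md
§5a, where the same hook with the cell's certified SDP brackets is tabulated. -/
@[conjecture] def StiffnessCeilingHalfFillingU8 : Prop :=
  ∀ (ρs θ₀ r : ℝ), 0 < ρs → 0 < θ₀ →
    (∃ L₀ : ℕ, ∀ (L : ℕ) [NeZero L], L₀ ≤ L → Even L →
      ∀ θ : ℝ, |θ| ≤ θ₀ → ρs * θ ^ 2 ≤ fluxEnergy L 8 0 θ - fluxEnergy L 8 0 0) →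
    energyDensity2D 1 8 1 ≤ r → ρs ≤ (2 * (r + 1.0897) + 0.74512) / 4

/-- The worked instance with an explicit `L₀`. -/
theorem stiffness_halfFilling_U8_le {ρs θ₀ r : ℝ} (hρs : 0 < ρs) (hθ₀ : 0 < θ₀) {L₀ : ℕ}
    (hst : ∀ (L : ℕ) [NeZero L], L₀ ≤ L → Even L →
      ∀ θ : ℝ, |θ| ≤ θ₀ → ρs * θ ^ 2 ≤ fluxEnergy L 8 0 θ - fluxEnergy L 8 0 0)
    (hr : energyDensity2D 1 8 1 ≤ r) :
    ρs ≤ (2 * (r + 1.0897) + 0.74512) / 4 := by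
  have h8 : (-0.74512 : ℝ) ≤ energyDensity2D 1 8 (1 - 0) := by
    rw [sub_zero]; exact energyDensity2D_one_eight_one_ge
  have h4 : (-1.0897 : ℝ) ≤ energyDensity2D 1 4 (1 - 0) := by
    rw [sub_zero]; exact energyDensity2D_one_four_one_ge
  have hr' : energyDensity2D 1 8 (1 - 0) ≤ r := by rw [sub_zero]; exact hr
  have h := stiffness_le_of_energyDensityBrackets (U := 8) (U₁ := 4) (δ := 0) (by norm_num)
    (by norm_num) (by norm_num) (by norm_num) hρs hθ₀ hst h8 hr' h4
  have hring : (8 : ℝ) * ((r - -1.0897) / (8 - 4)) - -0.74512 = 2 * (r + 1.0897) + 0.74512 := by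
    ring
  linarith

/-- **Proof of `StiffnessCeilingHalfFillingU8`.** -/
theorem stiffnessCeilingHalfFillingU8_holds : StiffnessCeilingHalfFillingU8 := by
  intro ρs θ₀ r hρs hθ₀ hst hr
  obtain ⟨L₀, hst⟩ := hst
  exact stiffness_halfFilling_U8_le hρs hθ₀ hst hr

/-! ### Thermodynamic limit for the `t–t'` class (bounds.tex Cor. hook, TL form with `t'`) -/

/-- The zero-flux `t–t'` envelope is the canonical `N_L`-particle ground energy of the `t–t'` torus
(`E(2n) = E(2n, S^z = 0)` by the `SU(2)` symmetry of `hubbardTorusTT'`,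
`groundEnergy_hubbardTorusTT'_eq_minEnergyOn_szSector`). -/
theorem fluxEnergyTT'_zero_eq_groundEnergy (t' U δ : ℝ) (hδ : -1 ≤ δ) :
    fluxEnergyTT' L t' U δ 0 = groundEnergy (hubbardTorusTT' L 1 t' U) (rectN (1 - δ) L) := by
  have hn : ⌊(1 - δ) * (L : ℝ) ^ 2 / 2⌋₊ ≤ Fintype.card (FermionTorus 2 L) := by
    rw [NoGo.card_fermionTorus_two]; exact NoGo.floor_pairNumber_le δ hδ L
  rw [rectN, fluxEnergyTT'_zero_eq_sectorEnergyTT',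
    groundEnergy_hubbardTorusTT'_eq_minEnergyOn_szSector L 1 t' U hn]
  rfl

/-- **Sharp finite-volume form of the `t–t'` ceiling** (exact zero-flux energies in place of the
brackets): `ρ_s L² ≤ (U (E(U) - E(U₁))/(U - U₁) - E(U) + t' (E(U) - E_{t₃}(U))/(t₃ - t')) / 4`. -/
theorem stiffnessTT'_mul_sq_le_of_fluxEnergyTT' (hL : 3 ≤ L) {t' t₃ U U₁ δ ρs θ₀ : ℝ} (hδ : -1 ≤ δ)
    (ht' : t' ≤ 0) (ht₃ : t₃ < t') (hU : 0 ≤ U) (hU₁ : U₁ < U) (hρs : 0 < ρs) (hθ₀ : 0 < θ₀)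
    (hst : ∀ θ : ℝ, |θ| ≤ θ₀ → ρs * θ ^ 2 ≤ fluxEnergyTT' L t' U δ θ - fluxEnergyTT' L t' U δ 0) :
    ρs * (L : ℝ) ^ 2 ≤ (U * ((fluxEnergyTT' L t' U δ 0 - fluxEnergyTT' L t' U₁ δ 0) / (U - U₁)) -
      fluxEnergyTT' L t' U δ 0 +
      t' * ((fluxEnergyTT' L t' U δ 0 - fluxEnergyTT' L t₃ U δ 0) / (t₃ - t'))) / 4 :=
  stiffnessCeilingFromEnergyBracketsTT'_holds L hL t' t₃ U U₁ δ ρs θ₀ hδ ht' ht₃ hU hU₁ hρs hθ₀ hst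
    _ _ _ _ le_rfl le_rfl le_rfl le_rfl

/-- The energy per site of the `N_L(n)`-particle ground state of the `L × L` `t–t'` torus. -/
def torusEnergyPerSiteTT' (t' U n : ℝ) (L : ℕ) : ℝ :=
  groundEnergy (hubbardTorusTT' L 1 t' U) (rectN n L) / (L : ℝ) ^ 2

/-- Arithmetic: divide the finite-volume two-chord ceiling (chords in `U` and in `t'`) by `c > 0`. -/
private theorem four_mul_le_of_sq_TT' {ρ U U₁ t' t₃ E E₁ E₃ c : ℝ} (hc : 0 < c)
    (h : ρ * c ≤ (U * ((E - E₁) / (U - U₁)) - E + t' * ((E - E₃) / (t₃ - t'))) / 4) :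
    4 * ρ ≤ U * ((E / c - E₁ / c) / (U - U₁)) - E / c + t' * ((E / c - E₃ / c) / (t₃ - t')) := by
  have key : U * ((E / c - E₁ / c) / (U - U₁)) - E / c + t' * ((E / c - E₃ / c) / (t₃ - t')) =
      (U * ((E - E₁) / (U - U₁)) - E + t' * ((E - E₃) / (t₃ - t'))) / c := by
    ring
  rw [key, le_div_iff₀ hc]
  linarith

/-- **Thermodynamic-limit slope ceiling for the `t–t'` class.** If `ρ_s > 0` is a flux stiffness of
the `(N_L, S^z = 0)` sectors of `hubbardTorusTT' L 1 t' U` for all large even `L`, then for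
`t₃ < t' ≤ 0`, `0 ≤ U₁ < U`, `-1 < δ ≤ 1`, with `e_{s}(V) = energyDensityTT' 1 s V (1 - δ)`
(Ruelle's energy density of the `t–t'` model, `HubbardNNNHoppingThermodynamicLimit`):
`ρ_s ≤ (U (e_{t'}(U) - e_{t'}(U₁))/(U - U₁) - e_{t'}(U) + t' (e_{t'}(U) - e_{t₃}(U))/(t₃ - t')) / 4`. -/
theorem stiffnessTT'_le_of_energyDensity_slope {t' t₃ U U₁ δ ρs θ₀ : ℝ} (ht' : t' ≤ 0)
    (ht₃ : t₃ < t') (hU₁ : 0 ≤ U₁) (hU : U₁ < U) (hδ1 : -1 < δ) (hδ2 : δ ≤ 1) (hρs : 0 < ρs)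
    (hθ₀ : 0 < θ₀) {L₀ : ℕ}
    (hst : ∀ (L : ℕ) [NeZero L], L₀ ≤ L → Even L →
      ∀ θ : ℝ, |θ| ≤ θ₀ → ρs * θ ^ 2 ≤ fluxEnergyTT' L t' U δ θ - fluxEnergyTT' L t' U δ 0) :
    ρs ≤ (U * ((energyDensityTT' 1 t' U (1 - δ) - energyDensityTT' 1 t' U₁ (1 - δ)) / (U - U₁)) -
      energyDensityTT' 1 t' U (1 - δ) +
      t' * ((energyDensityTT' 1 t' U (1 - δ) - energyDensityTT' 1 t₃ U (1 - δ)) / (t₃ - t'))) / 4 := by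
  have hU0 : 0 ≤ U := hU₁.trans hU.le
  have hn0 : 0 ≤ 1 - δ := by linarith
  have hn2 : 1 - δ < 2 := by linarith
  have ha : Tendsto (torusEnergyPerSiteTT' t' U (1 - δ)) atTop
      (𝓝 (energyDensityTT' 1 t' U (1 - δ))) :=
    tendsto_energyDensityTT'_torus 1 t' hU0 hn0 hn2
  have hb : Tendsto (torusEnergyPerSiteTT' t' U₁ (1 - δ)) atTop
      (𝓝 (energyDensityTT' 1 t' U₁ (1 - δ))) :=
    tendsto_energyDensityTT'_torus 1 t' hU₁ hn0 hn2
  have hc : Tendsto (torusEnergyPerSiteTT' t₃ U (1 - δ)) atTop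
      (𝓝 (energyDensityTT' 1 t₃ U (1 - δ))) :=
    tendsto_energyDensityTT'_torus 1 t₃ hU0 hn0 hn2
  have hg : Tendsto (fun L : ℕ => U * ((torusEnergyPerSiteTT' t' U (1 - δ) L -
      torusEnergyPerSiteTT' t' U₁ (1 - δ) L) / (U - U₁)) - torusEnergyPerSiteTT' t' U (1 - δ) L +
      t' * ((torusEnergyPerSiteTT' t' U (1 - δ) L - torusEnergyPerSiteTT' t₃ U (1 - δ) L) /
        (t₃ - t'))) atTop
      (𝓝 (U * ((energyDensityTT' 1 t' U (1 - δ) - energyDensityTT' 1 t' U₁ (1 - δ)) / (U - U₁)) -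
        energyDensityTT' 1 t' U (1 - δ) +
        t' * ((energyDensityTT' 1 t' U (1 - δ) - energyDensityTT' 1 t₃ U (1 - δ)) / (t₃ - t')))) :=
    ((((ha.sub hb).div_const (U - U₁)).const_mul U).sub ha).add
      (((ha.sub hc).div_const (t₃ - t')).const_mul t')
  have h2 : Tendsto (fun m : ℕ => 2 * m) atTop atTop :=
    tendsto_atTop_mono (fun m : ℕ => (by omega : m ≤ 2 * m)) tendsto_id
  have hev : ∀ᶠ m : ℕ in atTop, 4 * ρs ≤ U * ((torusEnergyPerSiteTT' t' U (1 - δ) (2 * m) -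
      torusEnergyPerSiteTT' t' U₁ (1 - δ) (2 * m)) / (U - U₁)) -
      torusEnergyPerSiteTT' t' U (1 - δ) (2 * m) +
      t' * ((torusEnergyPerSiteTT' t' U (1 - δ) (2 * m) -
        torusEnergyPerSiteTT' t₃ U (1 - δ) (2 * m)) / (t₃ - t')) := by
    refine Filter.eventually_atTop.2 ⟨max L₀ 2, fun m hm => ?_⟩
    have hm2 : 2 ≤ m := le_trans (le_max_right _ _) hm
    have hL₀ : L₀ ≤ 2 * m := le_trans (le_trans (le_max_left _ _) hm) (by omega)
    haveI : NeZero (2 * m) := ⟨by omega⟩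
    have hL3 : 3 ≤ 2 * m := by omega
    have hfin := stiffnessTT'_mul_sq_le_of_fluxEnergyTT' (L := 2 * m) hL3 hδ1.le ht' ht₃ hU0 hU hρs
      hθ₀ (hst (2 * m) hL₀ (even_two_mul m))
    rw [fluxEnergyTT'_zero_eq_groundEnergy (L := 2 * m) t' U δ hδ1.le,
      fluxEnergyTT'_zero_eq_groundEnergy (L := 2 * m) t' U₁ δ hδ1.le,
      fluxEnergyTT'_zero_eq_groundEnergy (L := 2 * m) t₃ U δ hδ1.le] at hfin
    have hLpos : (0 : ℝ) < ((2 * m : ℕ) : ℝ) ^ 2 := by positivity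
    exact four_mul_le_of_sq_TT' hLpos hfin
  have hlim := ge_of_tendsto (hg.comp h2) hev
  linarith

/-- **Thermodynamic-limit certified-bracket stiffness ceiling for the `t–t'` class.** Under the
hypotheses of `stiffnessTT'_le_of_energyDensity_slope`, thermodynamic-limit brackets
`em ≤ e_{t'}(U) ≤ r`, `l₁ ≤ e_{t'}(U₁)`, `l₃ ≤ e_{t₃}(U)` give
`ρ_s ≤ (U (r - l₁)/(U - U₁) - em + t' (r - l₃)/(t₃ - t')) / 4`. -/
theorem stiffnessTT'_le_of_energyDensityBrackets {t' t₃ U U₁ δ ρs θ₀ : ℝ} (ht' : t' ≤ 0)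
    (ht₃ : t₃ < t') (hU₁ : 0 ≤ U₁) (hU : U₁ < U) (hδ1 : -1 < δ) (hδ2 : δ ≤ 1) (hρs : 0 < ρs)
    (hθ₀ : 0 < θ₀) {L₀ : ℕ}
    (hst : ∀ (L : ℕ) [NeZero L], L₀ ≤ L → Even L →
      ∀ θ : ℝ, |θ| ≤ θ₀ → ρs * θ ^ 2 ≤ fluxEnergyTT' L t' U δ θ - fluxEnergyTT' L t' U δ 0)
    {em r l₁ l₃ : ℝ} (hem : em ≤ energyDensityTT' 1 t' U (1 - δ))
    (hr : energyDensityTT' 1 t' U (1 - δ) ≤ r) (hl₁ : l₁ ≤ energyDensityTT' 1 t' U₁ (1 - δ))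
    (hl₃ : l₃ ≤ energyDensityTT' 1 t₃ U (1 - δ)) :
    ρs ≤ (U * ((r - l₁) / (U - U₁)) - em + t' * ((r - l₃) / (t₃ - t'))) / 4 := by
  have h := stiffnessTT'_le_of_energyDensity_slope ht' ht₃ hU₁ hU hδ1 hδ2 hρs hθ₀ hst
  have hd : 0 < U - U₁ := sub_pos.2 hU
  have hmono : (energyDensityTT' 1 t' U (1 - δ) - energyDensityTT' 1 t' U₁ (1 - δ)) / (U - U₁) ≤
      (r - l₁) / (U - U₁) :=
    div_le_div_of_nonneg_right (by linarith) hd.le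
  have hU0 : 0 ≤ U := hU₁.trans hU.le
  have hUD := mul_le_mul_of_nonneg_left hmono hU0
  have hq : (r - l₃) / (t₃ - t') ≤
      (energyDensityTT' 1 t' U (1 - δ) - energyDensityTT' 1 t₃ U (1 - δ)) / (t₃ - t') :=
    div_le_div_of_nonpos_of_le (by linarith) (by linarith)
  have htq := mul_le_mul_of_nonpos_left hq ht'
  linarith

/-- **Thermodynamic-limit certified-bracket stiffness ceiling for the `t–t'` class (bounds.tex Cor.
hook, TL form; PROVED below).** For `t₃ < t' ≤ 0`, `0 ≤ U₁ < U`, `-1 < δ ≤ 1`: if `ρ_s > 0` is a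
flux stiffness (`ρ_s θ² ≤ E_L(θ) - E_L(0)` for `|θ| ≤ θ₀`) of the `(N_L, S^z = 0)` sectors of
`hubbardTorusTT' L 1 t' U` for all even `L ≥ L₀`, then every quadruple of thermodynamic-limit brackets
`em ≤ e_{t'}(U) ≤ r`, `l₁ ≤ e_{t'}(U₁)`, `l₃ ≤ e_{t₃}(U)`
(`e_s(V) = ThermodynamicLimit.energyDensityTT' 1 s V (1 - δ)`) gives
`ρ_s ≤ (U (r - l₁)/(U - U₁) - em + t' (r - l₃)/(t₃ - t')) / 4`. The typed TL rows of the tree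
(`Bounds/ClusterLowerBounds`: `clusterLowerTL_…`, `Bounds/OpenClusterTLUpperRows[3x4]`: `tlUpper_…`)
are exactly such brackets; the certified column is EXTREMISERS.md §5a. -/
@[conjecture] def StiffnessCeilingFromEnergyDensityBracketsTT' : Prop :=
  ∀ (t' t₃ U U₁ δ ρs θ₀ : ℝ), t' ≤ 0 → t₃ < t' → 0 ≤ U₁ → U₁ < U → -1 < δ → δ ≤ 1 → 0 < ρs →
    0 < θ₀ →
    (∃ L₀ : ℕ, ∀ (L : ℕ) [NeZero L], L₀ ≤ L → Even L →
      ∀ θ : ℝ, |θ| ≤ θ₀ → ρs * θ ^ 2 ≤ fluxEnergyTT' L t' U δ θ - fluxEnergyTT' L t' U δ 0) →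
    ∀ (em r l₁ l₃ : ℝ), em ≤ energyDensityTT' 1 t' U (1 - δ) → energyDensityTT' 1 t' U (1 - δ) ≤ r →
      l₁ ≤ energyDensityTT' 1 t' U₁ (1 - δ) → l₃ ≤ energyDensityTT' 1 t₃ U (1 - δ) →
      ρs ≤ (U * ((r - l₁) / (U - U₁)) - em + t' * ((r - l₃) / (t₃ - t'))) / 4

/-- **Proof of `StiffnessCeilingFromEnergyDensityBracketsTT'`.** -/
theorem stiffnessCeilingFromEnergyDensityBracketsTT'_holds :
    StiffnessCeilingFromEnergyDensityBracketsTT' := by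
  intro t' t₃ U U₁ δ ρs θ₀ ht' ht₃ hU₁ hU hδ1 hδ2 hρs hθ₀ hst em r l₁ l₃ hem hr hl₁ hl₃
  obtain ⟨L₀, hst⟩ := hst
  exact stiffnessTT'_le_of_energyDensityBrackets ht' ht₃ hU₁ hU hδ1 hδ2 hρs hθ₀ hst hem hr hl₁ hl₃

/-- Consistency at `t' = 0`: the `t–t'` TL ceiling gives back the nearest-neighbour one
(`energyDensityTT'_zero`, `fluxEnergyTT'_tPrime_zero`; take `t₃ = -1`, `l₃ = e_{-1}(U)`). -/
theorem stiffnessCeilingFromEnergyDensityBrackets_of_TT'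
    (h : StiffnessCeilingFromEnergyDensityBracketsTT') : StiffnessCeilingFromEnergyDensityBrackets := by
  intro U U₁ δ ρs θ₀ hU₁ hU hδ1 hδ2 hρs hθ₀ hst em r l₁ hem hr hl₁
  obtain ⟨L₀, hst⟩ := hst
  have h' := h 0 (-1) U U₁ δ ρs θ₀ le_rfl (by norm_num) hU₁ hU hδ1 hδ2 hρs hθ₀
    ⟨L₀, fun L _ hL₀ hE => by simpa only [fluxEnergyTT'_tPrime_zero] using hst L hL₀ hE⟩
    em r l₁ (energyDensityTT' 1 (-1) U (1 - δ))
    (by simpa only [energyDensityTT'_zero] using hem) (by simpa only [energyDensityTT'_zero] using hr)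
    (by simpa only [energyDensityTT'_zero] using hl₁) le_rfl
  linarith


end Summit.HubbardSuperconductivity.HubbardLadder.Bounds

end
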